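import Mathlib
import HarnessLib
import Summits.HubbardSuperconductivity.HubbardSuperconductivity.Theorems.KLProgrammeKLRegimeTwoVolumeSrcTowerProducer
import Summits.HubbardSuperconductivity.HubbardSuperconductivity.Theorems.KLProgrammeKLRegimeTwoVolumeSrcTowerInductionFA

/-!
# Route `KLProgramme` — crux K3, VL child `KLRegimeVolumeLimitV17F3` (stmt-HubbardSuperconductivity-23356), producer route «(VL)-SRC-SOFT» §S5c-2 at a
# GENERIC SOURCE FAMILY, (K5′) atom with EXISTENTIAL constant, UV atom HISTORY-BOUND, and E1's read-out with the DEGREE-2 LAW RE-TYPED AT `ε_{n_β+1}`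
# (cure (c1) of «(VL)-HE1-LEVEL0-DEG2», step F5c-A; seat hubbard-kl-k3c4-p1 g20; `--supports` 23356)

Twin of `…TwoVolumeSrcTowerProducerF.srcProfilesHF_of_atomsT'` / `…ProducerT.srcProfilesH_of_atomsT` (p680765):
* the UV atom `HUV` and the conclusion (token #24 at every level, amplitude AFTER the binder's `TowerP`) are stated for an ARBITRARY source family
  `F L M : Fin 1 → FreqMomentum L M → ℂ` (`…TwoVolumeSourceProfileDefsF.SourceProfilesAtLevF`; the skeleton takes `F L M := srcWindowFamily L M`, pen (R303)
  «srcUV-W») — the blocked tower is blind to the source family (`…SrcTowerInductionF.sourceProfilesAtLevF_allLevels`);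
* the (K5′) atom is `HOscT′`: tower-bound AND with the constant `∃ c″ ≥ 0` right after `R.WF2 →` (pen (R303) «flowPieceOscT′», = the conclusion of p2 g25's
  `…VolumeLimitHOscTOfChildren.hoscTAtom_of_children`); the block data are read at `c″ + 1` (`…SrcTowerProducer.srcTower_blockData_const` takes any `c″ > 0`);
* the UV atom `HUV` is HISTORY-BOUND (p3 g21's located point «(VL)-HUV-FRAME», KL STATUS 00:38Z/01:06Z: every supplier of the levels `0, 1` needs `FrameOK` of the
  frame — in the tree only from history — and, at level `1`, E1's history- and (K5′)-bound overlap rows): it takes the osc constant `c″ > 0` right after `R.WF2`, and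
  its conclusion is asked only under `HistP klPredsV17F2 L M G P Q R β U μ 0 (n_β+1)`, the (K5′) clauses at `c″` and `Z^{K_top}_{Λ_{k+1}} ≠ 0` (`k ≤ n_β`) — all three
  are in scope where the producer reads the UV levels (`histP_top_of_towerP`, the `HOscT′` atom, `HE1free`).
Everything else (packages, `d′`, `R`, the one smallness `ε₀`, thresholds, amplitude `W^{3^j}`) is byte-identical to the plain producer.

* `HE1` is `stub_vl_HE1free′`: the landed text with its degree-2 law re-typed — `S₀ j (2m) ≤ C₀·klWtBudget P Q₁ U (j+1) (2m)` only for `m ≥ 2`, and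
  `S₀ j 2 ≤ C₀·Q₁.CE·ε_{n_β+1}·4^{−(j+1)}` (the certified `O(ε_{n_β+1})` shape of p3 g20's F7 at the top frame; WEAKER than the old text at every level);
  the tower is `…SrcTowerInductionFA.sourceProfilesAtLevF_allLevels'` (free alive degree-2 slot `aal := C₀·Q₁.CE·ε₀`, `ε₀ ≥ ε_{n_β+1}` the one smallness),
  and the two rows carrying `aal` are dominated by `…SrcTowerRows.twoScale_rows_of_small` at `2C₀` (`twoScale_rows_aal_of_twoC₀`).
* **`srcProfilesHF_of_atomsTHA`** — the producer.

Composition of landed theorems + real arithmetic; nothing about the model is asserted beyond them; nothing asserts the atoms, VL, K3 or superconductivity.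
References: BGM 2006 §2.7–§2.9, §3 (3.2)–(3.8) [cite: BenfattoGiulianiMastropietro2006]; Gawȩdzki–Kupiainen 1985 §3 [cite: GawedzkiKupiainen1985GrossNeveu].
-/

noncomputable section

namespace Summit.HubbardSuperconductivity.HubbardSuperconductivity.Theorems.TwoVolumeDefect

set_option linter.dupNamespace false -- summit = problem name (single-conjunct summit), D-0017

open Real Finset Filter Topology Literature.MathematicalPhysics.QuantumLattice GrassmannAlgebra Literature.Probability.LatticeModels
open Literature.Probability.LatticeModels.BattleFederbush
open Summit.HubbardSuperconductivity.HubbardSuperconductivity.Theorems.KLProgrammeLegKernels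
open Summit.HubbardSuperconductivity.HubbardSuperconductivity.Theorems.KLRegimeSplit
open Summit.HubbardSuperconductivity.HubbardSuperconductivity.Theorems.EngineV8
open Summit.HubbardSuperconductivity.HubbardSuperconductivity.Theorems.TwoVolumeSource
open Summit.HubbardSuperconductivity.HubbardSuperconductivity.Theorems.TorusFourierL2
open Summit.HubbardSuperconductivity.HubbardSuperconductivity.Theorems.DispersionFlow

/-- **The two rows carrying the alive degree-2 slot are dominated by `twoScale_rows_of_small` at `2C₀`** (`aal := C₀·Q₁·lam`): the `w`-row differs by
`Φ·2τR·C₀(Q₁/R)² ≥ 0`, the `V`-row by `Φ·4lam(eτ)²·C₀Q₁² ≥ 0`. [folklore] -/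
theorem twoScale_rows_aal_of_twoC₀ {Φ τ C₀ Q₁ R lam t₀ : ℝ} (hΦ : 0 ≤ Φ) (hτ : 0 ≤ τ) (hC₀ : 0 ≤ C₀) (hR : 0 < R) (hlam : 0 ≤ lam)
    (hw : Φ * (2 * τ * R * (lam * (2 * C₀ * Q₁ / (2 * R) + 2 * t₀ / 2) + (2 * t₀ / (2 * R) + 2 * C₀ * (Q₁ / R) ^ 2 + 2 * t₀))) ≤ 1 / 2)
    (hV : Φ * (Real.exp 1 * τ * (lam * (2 * C₀ * Q₁ + 2 * t₀ * R) + 2 * t₀) + 4 * lam * (Real.exp 1 * τ) ^ 2 * (2 * C₀ * Q₁ ^ 2 + 2 * t₀ * R ^ 2)) ≤ 1 / 2) :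
    Φ * (2 * τ * R * (lam * (C₀ * Q₁ / (2 * R) + 2 * t₀ / 2) + ((2 * t₀ + C₀ * Q₁ * lam) / (2 * R) + C₀ * (Q₁ / R) ^ 2 + 2 * t₀))) ≤ 1 / 2 ∧
    Φ * (Real.exp 1 * τ * (lam * (C₀ * Q₁ + 2 * t₀ * R) + (2 * t₀ + C₀ * Q₁ * lam)) + 4 * lam * (Real.exp 1 * τ) ^ 2 * (C₀ * Q₁ ^ 2 + 2 * t₀ * R ^ 2)) ≤ 1 / 2 := by
  have hR0 : R ≠ 0 := hR.ne'
  constructor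
  · have hdiff : Φ * (2 * τ * R * (lam * (2 * C₀ * Q₁ / (2 * R) + 2 * t₀ / 2) + (2 * t₀ / (2 * R) + 2 * C₀ * (Q₁ / R) ^ 2 + 2 * t₀))) -
        Φ * (2 * τ * R * (lam * (C₀ * Q₁ / (2 * R) + 2 * t₀ / 2) + ((2 * t₀ + C₀ * Q₁ * lam) / (2 * R) + C₀ * (Q₁ / R) ^ 2 + 2 * t₀))) =
        Φ * (2 * τ * R * (C₀ * (Q₁ / R) ^ 2)) := by
      field_simp
      ring
    have hnn : 0 ≤ Φ * (2 * τ * R * (C₀ * (Q₁ / R) ^ 2)) := by positivity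
    linarith
  · have hdiff : Φ * (Real.exp 1 * τ * (lam * (2 * C₀ * Q₁ + 2 * t₀ * R) + 2 * t₀) + 4 * lam * (Real.exp 1 * τ) ^ 2 * (2 * C₀ * Q₁ ^ 2 + 2 * t₀ * R ^ 2)) -
        Φ * (Real.exp 1 * τ * (lam * (C₀ * Q₁ + 2 * t₀ * R) + (2 * t₀ + C₀ * Q₁ * lam)) + 4 * lam * (Real.exp 1 * τ) ^ 2 * (C₀ * Q₁ ^ 2 + 2 * t₀ * R ^ 2)) =
        Φ * (4 * lam * (Real.exp 1 * τ) ^ 2 * (C₀ * Q₁ ^ 2)) := by ring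
    have hnn : 0 ≤ Φ * (4 * lam * (Real.exp 1 * τ) ^ 2 * (C₀ * Q₁ ^ 2)) := by positivity
    linarith

set_option maxHeartbeats 3200000 in -- long binder blocks threaded through six suppliers (as in `srcProfilesH_of_atomsT`)
open Classical in
/-- **THE PRODUCER AT A GENERIC SOURCE FAMILY — token #24-F at every level, history-bound, from `HE1free`, the tower-bound (K5′) atom with an
EXISTENTIAL constant `HOscT′` (p2 g25's `hoscTAtom_of_children` text) and the HISTORY-BOUND UV levels `HUV` in the currency `F`** (twin of
`srcProfilesH_of_atomsT`; the (K5′) constant `c″` is read from the atom instead of `klReadOscC P R`, the blocked tower runs at the source family `F L M`, the UV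
levels are read under the top history, the (K5′) clauses and `Z ≠ 0`).
[cite: BenfattoGiulianiMastropietro2006, §2.7-§2.9, §3 (3.2)-(3.8); cite: GawedzkiKupiainen1985GrossNeveu, §3] -/
theorem srcProfilesHF_of_atomsTHA
    (HE1 : ∀ (P : SplitConsts) (R : RenConsts), P.WF → R.WF2 →
      ∃ Q₁ : EngConsts, 0 ≤ Q₁.CE ∧ ∃ C₀ : ℝ, 0 ≤ C₀ ∧
        ∃ c₇ : ℝ, 0 < c₇ ∧ ∀ c : ℝ, 0 < c → c ≤ c₇ → ∃ U₇ : ℝ, 0 < U₇ ∧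
          ∀ μ ∈ klWindowC, ∀ U : ℝ, 0 < U → U ≤ U₇ → ∀ β : ℝ, klBetaMin ≤ β → β ≤ Real.exp (c / U ^ 2) →
            ∃ S₀ : ℕ → ℕ → ℝ, (∀ j m, 0 ≤ S₀ j m) ∧ (∀ j, j ≤ nScales β → ∀ m, 2 ≤ m → S₀ j (2 * m) ≤ C₀ * klWtBudget P Q₁ U (j + 1) (2 * m)) ∧
            (∀ j, j ≤ nScales β → S₀ j 2 ≤ C₀ * Q₁.CE * epsCoupling P U (nScales β + 1) * ((4 : ℝ) ^ (j + 1))⁻¹) ∧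
            ∃ L₂ : ℕ, ∃ M₂ : ℕ → ℕ, ∀ (L M : ℕ) [NeZero L] [NeZero M], L₂ ≤ L → M₂ L ≤ M →
              (∀ k, k ≤ nScales β → hubbardEffPartitionFnCT L M β U μ 0 (klFlowFrameU L M β U μ (nScales β + 1)) (klScale klE0 (k + 1)) ≠ 0) ∧
              (∀ j, j ≤ nScales β → ∀ (m : ℕ) (q : Fin m) (w : SpaceTimeIdx L M × SectorLeg (sectorCount j)),
                klWtPinnedSumAt L M β μ (klFlowFrameU L M β U μ (nScales β + 1)) j j m (klEffectiveAction L M β U μ (klFlowFrameU L M β U μ (nScales β + 1)) klE0 (j + 1)) q w ≤ S₀ j m))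
    (HOscT' : ∀ (G : GeoConsts) (P : SplitConsts) (Q : EngConsts) (R : RenConsts), P.WF → R.WF2 →
      ∃ c'' : ℝ, 0 ≤ c'' ∧ ∃ c₇ : ℝ, 0 < c₇ ∧ ∀ c : ℝ, 0 < c → c ≤ c₇ → ∃ U₇ : ℝ, 0 < U₇ ∧
        ∀ μ ∈ klWindowC, ∀ U : ℝ, 0 < U → U ≤ U₇ → ∀ β : ℝ, klBetaMin ≤ β → β ≤ Real.exp (c / U ^ 2) →
          ∀ (K : TrigPolyC4v) (Lstar : ℕ) (Mstar : ℕ → ℕ), TowerP klPredsV17F2 G P Q R β U μ K Lstar Mstar →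
          ∃ L₂ : ℕ, ∃ M₂ : ℕ → ℕ, ∀ (L M : ℕ) [NeZero L] [NeZero M], L₂ ≤ L → M₂ L ≤ M →
            ∀ m : ℕ, 1 ≤ m → m < nScales β + 1 → FlowPieceOscAt L M c'' β U μ m)
    (F : (L M : ℕ) → (Fin 1 → FreqMomentum L M → ℂ))
    (HUV : ∀ (G : GeoConsts) (P : SplitConsts) (Q : EngConsts) (R : RenConsts), P.WF → R.WF2 → ∀ c'' : ℝ, 0 < c'' →
      ∃ Q₀ : EngConsts, 0 ≤ Q₀.CE ∧ ∃ c₀ : ℝ, 0 < c₀ ∧ ∀ c : ℝ, 0 < c → c ≤ c₀ → ∃ U₀ : ℝ, 0 < U₀ ∧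
        ∀ μ ∈ klWindowC, ∀ U : ℝ, 0 < U → U ≤ U₀ → ∀ β : ℝ, klBetaMin ≤ β → β ≤ Real.exp (c / U ^ 2) →
          ∃ A₀ : ℝ, 0 ≤ A₀ ∧ ∃ L₁ : ℕ, ∃ M₁ : ℕ → ℕ, ∀ (L M : ℕ) [NeZero L] [NeZero M], L₁ ≤ L → M₁ L ≤ M →
            HistP klPredsV17F2 L M G P Q R β U μ 0 (nScales β + 1) →
            (∀ m : ℕ, 1 ≤ m → m < nScales β + 1 → FlowPieceOscAt L M c'' β U μ m) →
            (∀ k, k ≤ nScales β → hubbardEffPartitionFnCT L M β U μ 0 (klFlowFrameU L M β U μ (nScales β + 1)) (klScale klE0 (k + 1)) ≠ 0) →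
            ∀ j : ℕ, j ≤ 1 → j + 1 ≤ nScales β + 1 →
              SourceProfilesAtLevF L M (klSrcBudget P Q₀ U (fun _ _ => A₀) (j + 1)) β U μ (klFlowFrameU L M β U μ (nScales β + 1)) (F L M) j j (j + 1))
    (G : GeoConsts) (P : SplitConsts) (Q : EngConsts) (R : RenConsts) (hP : P.WF) (hR2 : R.WF2) :
    ∃ Q' : EngConsts, 0 ≤ Q'.CE ∧ ∃ c₀ : ℝ, 0 < c₀ ∧ ∀ c : ℝ, 0 < c → c ≤ c₀ → ∃ U₀ : ℝ, 0 < U₀ ∧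
      ∀ μ ∈ klWindowC, ∀ U : ℝ, 0 < U → U ≤ U₀ → ∀ β : ℝ, klBetaMin ≤ β → β ≤ Real.exp (c / U ^ 2) →
        ∀ (K : TrigPolyC4v) (Lstar : ℕ) (Mstar : ℕ → ℕ), TowerP klPredsV17F2 G P Q R β U μ K Lstar Mstar →
          ∃ A : ℕ → ℕ → ℝ, (∀ j s, 0 ≤ A j s) ∧ ∃ L₁ : ℕ, ∃ M₁ : ℕ → ℕ, ∀ (L M : ℕ) [NeZero L] [NeZero M], L₁ ≤ L → M₁ L ≤ M →
            ∀ j : ℕ, j + 1 ≤ nScales β + 1 →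
              SourceProfilesAtLevF L M (klSrcBudget P Q' U A (j + 1)) β U μ (klFlowFrameU L M β U μ (nScales β + 1)) (F L M) j j (j + 1) := by
  have hKl : 0 < P.Klam := lt_of_lt_of_le one_pos hP.1
  have hKl0 : 0 ≤ P.Klam := hKl.le
  have he : (0 : ℝ) < klE0 := by norm_num [klE0]
  have hlog4 : 0 < Real.log 4 := Real.log_pos (by norm_num)
  have hGfr : ∀ i, 0 ≤ R.Gfr i := gfr_nonneg_of_wf2 hR2
  -- the atoms' constants
  obtain ⟨Q₁, hQ₁, C₀, hC₀, c₇, hc₇, hHE⟩ := HE1 P R hP hR2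
  obtain ⟨c''₀, hc''₀, c₉, hc₉, hOsc⟩ := HOscT' G P Q R hP hR2
  -- the data constants before `d′`
  set c'' : ℝ := c''₀ + 1 with hc''def
  have hc''0 : 0 < c'' := by rw [hc''def]; linarith
  obtain ⟨Q₀, hQ₀, c₈, hc₈, hUV⟩ := HUV G P Q R hP hR2 c'' hc''0
  obtain ⟨Cκ, CJ, CJ', hCκ, hCJ, hCJ', hdataAll⟩ := srcTower_blockData_const R c'' hc''0
  -- the closed-form constants at `θ = 1`
  set σc : ℝ := 2 * Cκ * klE0 with hσc
  set τc : ℝ := Real.exp 1 ^ 4 * (1 + 1) ^ 2 * (2 * Cκ * klE0) with hτc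
  set ψc : ℝ := 1 / (1 ^ 2 * (2 * Cκ * klE0)) with hψc
  set Γ : ℝ := max 4 (2 * τc * ψc) with hΓ
  have hσ0 : 0 < σc := by positivity
  have hτ0 : 0 < τc := by positivity
  have hΓ0 : 0 ≤ Γ := le_trans (by norm_num) (le_max_left _ _)
  have hΓ1 : 1 ≤ Γ := le_trans (by norm_num) (le_max_left _ _)
  -- the block length `d′`
  obtain ⟨d₀, hd₀⟩ := pow_unbounded_of_one_lt ((81 * CJ' / 2 + 1) ^ 2 * Γ) (by norm_num : (1 : ℝ) < 2)
  set d' : ℕ := d₀ + 1 with hd'def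
  have hd'1 : 1 ≤ d' := by omega
  have hcore : max (81 * (2 : ℝ) ^ d' * CJ' / 2) 1 ^ 2 * Γ ≤ (8 : ℝ) ^ d' :=
    ccPrime_sq_mul_le_eight_pow hCJ'.le hΓ0 (hd₀.le.trans (pow_le_pow_right₀ (by norm_num) (by omega)))
  obtain ⟨Cb, hCb, hdata⟩ := hdataAll d'
  set cr' : ℝ := max (81 * CJ / 2) 1 with hcr'
  set ccd : ℝ := max (81 * (2 : ℝ) ^ d' * CJ' / 2) 1 with hccd
  have hcr'1 : 1 ≤ cr' := le_max_right _ _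
  have hccd1 : 1 ≤ ccd := le_max_right _ _
  set Φb : ℝ := 256 * Real.exp 1 * Cb * (4 : ℝ) ^ d' / Cκ with hΦb
  have hΦb0 : 0 ≤ Φb := by positivity
  have hΦle : ∀ ℓ : ℕ, ℓ ≤ d' → 256 * Real.exp 1 * Cb * (4 : ℝ) ^ ℓ / Cκ ≤ Φb := fun ℓ hℓ => by
    rw [hΦb]; gcongr; norm_num
  -- the per-pair constant and the packages
  set Rr : ℝ := max (max Q₁.CE Q₀.CE) (max 1 (16 * Φb * τc * (2 * C₀ * Q₁.CE ^ 2))) with hRr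
  have hR1 : 1 ≤ Rr := (le_max_left _ _).trans (le_max_right _ _)
  have hR0 : 0 < Rr := lt_of_lt_of_le one_pos hR1
  have hQ₁R : Q₁.CE ≤ Rr := (le_max_left _ _).trans (le_max_left _ _)
  have hQ₀R : Q₀.CE ≤ Rr := (le_max_right _ _).trans (le_max_left _ _)
  have hRbig : 16 * Φb * τc * (2 * C₀ * Q₁.CE ^ 2) ≤ Rr := (le_max_right _ _).trans (le_max_right _ _)
  set QR : EngConsts := { Q₁ with CE := Rr } with hQR
  set Qo : EngConsts := { Q₁ with CE := ccd ^ 2 * Γ * Rr } with hQo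
  have hQRCE : QR.CE = Rr := rfl
  have hQoCE : Qo.CE = ccd ^ 2 * Γ * Rr := rfl
  have hcc1 : 1 ≤ ccd ^ 2 * Γ := one_le_mul_of_one_le_of_one_le (one_le_pow₀ hccd1) hΓ1
  have hRQo : QR.CE ≤ Qo.CE := by rw [hQRCE, hQoCE]; exact le_mul_of_one_le_left hR0.le hcc1
  have hQo0 : 0 ≤ Qo.CE := hR0.le.trans hRQo
  -- one smallness
  set mM : ℝ := 64 * (Φb + 1) * (Real.exp 1 * τc + 1) ^ 2 * (σc + 1) * (Rr + 1) ^ 2 * (2 * C₀ * Q₁.CE + 2 * C₀ * Q₁.CE ^ 2 + 1) with hmM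
  have hmM0 : 0 < mM := by positivity
  set ε₀ : ℝ := min 1 (1 / mM) with hε₀
  have hε₀0 : 0 < ε₀ := lt_min one_pos (by positivity)
  have hε₀1 : ε₀ ≤ 1 := min_le_left _ _
  have hε₀m : ε₀ * mM ≤ 1 := by
    calc ε₀ * mM ≤ (1 / mM) * mM := mul_le_mul_of_nonneg_right (min_le_right _ _) hmM0.le
      _ = 1 := by field_simp
  -- the answer's package and `c₀`
  refine ⟨Qo, hQo0, ?_⟩
  set c₀ : ℝ := min (min (min c₇ c₈) (min c₉ (klEngC₃6 P R))) (ε₀ * Real.log 4 / (2 * P.Klam)) with hc₀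
  have hc₀0 : 0 < c₀ := lt_min (lt_min (lt_min hc₇ hc₈) (lt_min hc₉ (klEngC₃6_pos P R))) (by positivity)
  refine ⟨c₀, hc₀0, fun c hc hcc₀ => ?_⟩
  have hcc₇ : c ≤ c₇ := hcc₀.trans ((min_le_left _ _).trans ((min_le_left _ _).trans (min_le_left _ _)))
  have hcc₈ : c ≤ c₈ := hcc₀.trans ((min_le_left _ _).trans ((min_le_left _ _).trans (min_le_right _ _)))
  have hcc₉ : c ≤ c₉ := hcc₀.trans ((min_le_left _ _).trans ((min_le_right _ _).trans (min_le_left _ _)))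
  have hc6 : c ≤ klEngC₃6 P R := hcc₀.trans ((min_le_left _ _).trans ((min_le_right _ _).trans (min_le_right _ _)))
  have hcε : c ≤ ε₀ * Real.log 4 / (2 * P.Klam) := hcc₀.trans (min_le_right _ _)
  obtain ⟨U₇, hU₇, hHE'⟩ := hHE c hc hcc₇
  obtain ⟨U₈, hU₈, hUV'⟩ := hUV c hc hcc₈
  obtain ⟨U₉, hU₉, hOsc'⟩ := hOsc c hc hcc₉
  set U₀ : ℝ := min (min (min U₇ U₈) (min U₉ (klEngU₀4 P R c)))
    (min (min (klEngU₀3 P R c) (1 / (R.Gfr 3 + 1))) (min (1 / c'') (ε₀ / (2 * P.Klam)))) with hU₀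
  have hU₀0 : 0 < U₀ := by
    refine lt_min (lt_min (lt_min hU₇ hU₈) (lt_min hU₉ (klEngU₀4_pos P R c))) (lt_min (lt_min (klEngU₀3_pos P R c) ?_) (lt_min ?_ ?_))
    · have := hGfr 3; positivity
    · positivity
    · positivity
  refine ⟨U₀, hU₀0, fun μ hμ U hU hUU β hβmin hβc K Lstar Mstar hT => ?_⟩
  have hUU₇ : U ≤ U₇ := hUU.trans ((min_le_left _ _).trans ((min_le_left _ _).trans (min_le_left _ _)))
  have hUU₈ : U ≤ U₈ := hUU.trans ((min_le_left _ _).trans ((min_le_left _ _).trans (min_le_right _ _)))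
  have hUU₉ : U ≤ U₉ := hUU.trans ((min_le_left _ _).trans ((min_le_right _ _).trans (min_le_left _ _)))
  have hU4 : U ≤ klEngU₀4 P R c := hUU.trans ((min_le_left _ _).trans ((min_le_right _ _).trans (min_le_right _ _)))
  have hU3 : U ≤ min (klEngU₀3 P R c) (1 / (R.Gfr 3 + 1)) := hUU.trans ((min_le_right _ _).trans (min_le_left _ _))
  have hUc'' : U ≤ 1 / c'' := hUU.trans ((min_le_right _ _).trans ((min_le_right _ _).trans (min_le_left _ _)))
  have hUε : U ≤ ε₀ / (2 * P.Klam) := hUU.trans ((min_le_right _ _).trans ((min_le_right _ _).trans (min_le_right _ _)))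
  have hcU : c'' * U ≤ 1 := by rw [le_div_iff₀ hc''0] at hUc''; linarith
  have hβ : 0 < β := pos_of_klBetaMin_le hβmin
  -- the atoms at `(μ, U, β)`
  obtain ⟨S₀, hS₀0, hS₀law, hS₀two, L₂, M₂, hHE''⟩ := hHE' μ hμ U hU hUU₇ β hβmin hβc
  obtain ⟨A₀, hA₀, L₃, M₃, hUV''⟩ := hUV' μ hμ U hU hUU₈ β hβmin hβc
  obtain ⟨L₄, M₄, hOsc''⟩ := hOsc' μ hμ U hU hUU₉ β hβmin hβc K Lstar Mstar hT
  -- the amplitude base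
  set Gx : ℝ := (max (81 * CJ / 2) 1 * max (81 * (2 : ℝ) ^ d' * CJ' / 2) 1 * (2 : ℝ) ^ (5 * d') *
        (max 4 (2 * (Real.exp 1 ^ 4 * (1 + 1) ^ 2 * (2 * Cκ * klE0)) * (1 / (1 ^ 2 * (2 * Cκ * klE0)))) * QR.CE *
            ((C₀ + 2 * ε₀) * (1 + 8 * (2 * Cκ * klE0) * QR.CE) +
              Real.exp 1 * (C₀ * Q₁.CE / (2 * QR.CE) + 2 * ε₀ / 2 + ((2 * ε₀ + C₀ * Q₁.CE * ε₀) / (2 * QR.CE) + C₀ * (Q₁.CE / QR.CE) ^ 2 + 2 * ε₀))) +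
          ((C₀ + 2 * ε₀) * (1 + 8 * (2 * Cκ * klE0) * QR.CE) +
              Real.exp 1 * (C₀ * Q₁.CE / (2 * QR.CE) + 2 * ε₀ / 2 + ((2 * ε₀ + C₀ * Q₁.CE * ε₀) / (2 * QR.CE) + C₀ * (Q₁.CE / QR.CE) ^ 2 + 2 * ε₀))) +
          (2 * ε₀ + C₀ * Q₁.CE * ε₀))) / ε₀ ^ 2 with hGx
  set W : ℝ := max A₀ (16 * max 1 Gx) with hWdef
  have hA₀W : A₀ ≤ W := le_max_left _ _
  have hW : 16 * max 1 Gx ≤ W := le_max_right _ _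
  have hW0 : 0 ≤ W := hA₀.trans hA₀W
  refine ⟨fun i _ => W ^ 3 ^ i, fun j s => pow_nonneg hW0 _,
    max (max (klEngL₃ β U) L₂) (max (max L₃ L₄) Lstar), fun L => max (max (klEngM₃ β U L) (M₂ L)) (max (max (M₃ L) (M₄ L)) (Mstar L)), ?_⟩
  intro L M _ _ hL hM j hj
  have hL3 : klEngL₃ β U ≤ L := (le_max_left _ _).trans ((le_max_left _ _).trans hL)
  have hL2 : L₂ ≤ L := (le_max_right _ _).trans ((le_max_left _ _).trans hL)
  have hL₃ : L₃ ≤ L := (le_max_left _ _).trans ((le_max_left _ _).trans ((le_max_right _ _).trans hL))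
  have hL₄ : L₄ ≤ L := (le_max_right _ _).trans ((le_max_left _ _).trans ((le_max_right _ _).trans hL))
  have hLs : Lstar ≤ L := (le_max_right _ _).trans ((le_max_right _ _).trans hL)
  have hM3 : klEngM₃ β U L ≤ M := (le_max_left _ _).trans ((le_max_left _ _).trans hM)
  have hM2 : M₂ L ≤ M := (le_max_right _ _).trans ((le_max_left _ _).trans hM)
  have hM₃ : M₃ L ≤ M := (le_max_left _ _).trans ((le_max_left _ _).trans ((le_max_right _ _).trans hM))
  have hM₄ : M₄ L ≤ M := (le_max_right _ _).trans ((le_max_left _ _).trans ((le_max_right _ _).trans hM))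
  have hMs : Mstar L ≤ M := (le_max_right _ _).trans ((le_max_right _ _).trans hM)
  -- the history at the top and the (K5′) clauses
  have hhist : HistP klPredsV17F2 L M G P Q R β U μ 0 (nScales β + 1) := histP_top_of_towerP hT hLs hMs
  have hosc : ∀ m, 1 ≤ m → m < nScales β + 1 → FlowPieceOscAt L M c'' β U μ m := fun m h1 h2 =>
    (hOsc'' L M hL₄ hM₄ m h1 h2).mono (by rw [hc''def]; linarith)
  obtain ⟨hZ, hread⟩ := hHE'' L M hL2 hM2
  -- the couplings: `0 < ε_1`, `ε_{n_β+1} ≤ ε₀`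
  have hlampos : 0 < epsCoupling P U 1 := by
    unfold epsCoupling; rw [abs_of_pos hU]; push_cast; nlinarith [sq_nonneg U]
  have hreg : IsKLRegime U c (-((nScales β + 1 : ℕ) : ℤ)) := isKLRegime_of_le_nScales_succ hc.le hβmin hβc le_rfl
  have hlamMax : epsCoupling P U (nScales β + 1) ≤ ε₀ := by
    unfold epsCoupling
    rw [abs_of_pos hU]
    have hr : U ^ 2 * ((nScales β + 1 : ℕ) : ℝ) ≤ c / Real.log 4 := by
      have h := hreg
      unfold IsKLRegime at h
      rw [Int.cast_neg, Int.cast_natCast, abs_neg, Nat.abs_cast] at h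
      rw [le_div_iff₀ hlog4]; exact h
    have h1 : c / Real.log 4 ≤ ε₀ / (2 * P.Klam) := by
      rw [div_le_iff₀ hlog4]
      calc c ≤ ε₀ * Real.log 4 / (2 * P.Klam) := hcε
        _ = ε₀ / (2 * P.Klam) * Real.log 4 := by ring
    calc P.Klam * (U + U ^ 2 * ((nScales β + 1 : ℕ) : ℝ)) ≤ P.Klam * (ε₀ / (2 * P.Klam) + ε₀ / (2 * P.Klam)) :=
          mul_le_mul_of_nonneg_left (add_le_add hUε (hr.trans h1)) hKl0
      _ = ε₀ := by field_simp; ring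
  -- the rows at every `ℓ ≤ d′`
  have hrows : ∀ ℓ : ℕ, ℓ ≤ d' →
      2 * ε₀ * τc * Rr ≤ 1 ∧ 4 * σc * ε₀ * Rr ≤ 1 / 2 ∧ Real.exp 1 * τc * ε₀ * Rr ≤ 1 / 2 ∧
      (256 * Real.exp 1 * Cb * (4 : ℝ) ^ ℓ / Cκ) * (2 * τc * Rr * (ε₀ * (C₀ * Q₁.CE / (2 * Rr) + 2 * ε₀ / 2) +
        ((2 * ε₀ + C₀ * Q₁.CE * ε₀) / (2 * Rr) + C₀ * (Q₁.CE / Rr) ^ 2 + 2 * ε₀))) ≤ 1 / 2 ∧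
      (256 * Real.exp 1 * Cb * (4 : ℝ) ^ ℓ / Cκ) * (Real.exp 1 * τc * (ε₀ * (C₀ * Q₁.CE + 2 * ε₀ * Rr) + (2 * ε₀ + C₀ * Q₁.CE * ε₀)) +
        4 * ε₀ * (Real.exp 1 * τc) ^ 2 * (C₀ * Q₁.CE ^ 2 + 2 * ε₀ * Rr ^ 2)) ≤ 1 / 2 := fun ℓ hℓ => by
    have h2C₀ : (0 : ℝ) ≤ 2 * C₀ := by positivity
    obtain ⟨h1, h2, h3, h4, h5⟩ := twoScale_rows_of_small (by positivity) (hΦle ℓ hℓ) hτ0.le hσ0.le h2C₀ hQ₁ hR1 hRbig hε₀0.le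
      (by rw [hmM] at hε₀m; exact hε₀m) hε₀0.le le_rfl hε₀0.le le_rfl hε₀1
    exact ⟨h1, h2, h3, twoScale_rows_aal_of_twoC₀ (by positivity) hτ0.le hC₀ hR0 hε₀0.le h4 h5⟩
  -- the case `n_β = 0`: only the level `0`, read from the UV atom
  rcases Nat.eq_zero_or_pos (nScales β) with hN0 | hNpos
  · have hj0 : j = 0 := by omega
    subst hj0
    refine ((hUV'' L M hL₃ hM₃ hhist hosc hZ 0 (by omega) (by omega)).mono fun s m => ?_)
    exact (klSrcBudget_mono_CE P U (A := fun _ _ => A₀) (fun _ _ => hA₀) hQ₀ (hQ₀R.trans hRQo) hKl0 _ s m).trans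
      (klSrcBudget_mono_A P Qo U hQo0 hKl0 (A' := fun i _ => W ^ 3 ^ i) (fun i _ => hA₀W.trans (le_self_pow₀ ((le_max_left 1 Gx).trans
        (by linarith [le_max_right A₀ (16 * max 1 Gx), le_max_left (1:ℝ) Gx])) (by positivity))) _ s m)
  -- the induction over the blocks
  refine sourceProfilesAtLevF_allLevels' hβ U μ (klFlowFrameU L M β U μ (nScales β + 1)) (F L M) (d' := d') (N := nScales β) hd'1 P hKl0 Q₁ QR Qo hQ₁
    (by rw [hQRCE]; exact hR0) (by rw [hQRCE]; exact hQ₁R) hRQo hC₀ hε₀0 hε₀1 hlampos hlamMax hε₀1 hZ hCκ hCb (θ := 1) one_pos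
    (fun k ℓ hk hℓ hℓd hkℓ => hdata G P Q c hP hR2 hc hc6 μ hμ U hU hU3 hU4 hcU β hβmin hβc L M hL3 hM3 hhist hosc k ℓ hk hℓ hℓd hkℓ)
    S₀ hS₀0 hS₀law (fun j' hj' => (hS₀two j' hj').trans
      (mul_le_mul_of_nonneg_right (mul_le_mul_of_nonneg_left hlamMax (mul_nonneg hC₀ hQ₁)) (by positivity)))
    hread (A₀ := A₀) (fun j' hj' => ((hUV'' L M hL₃ hM₃ hhist hosc hZ j' hj' (by omega)).mono fun s m =>
      klSrcBudget_mono_CE P U (A := fun _ _ => A₀) (fun _ _ => hA₀) hQ₀ hQ₀R hKl0 _ s m))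
    (hrows d' le_rfl).1 (hrows d' le_rfl).2.1 (hrows d' le_rfl).2.2.1 (fun ℓ _ hℓd => (hrows ℓ hℓd).2.2.2.1) (fun ℓ _ hℓd => (hrows ℓ hℓd).2.2.2.2)
    (fun ℓ _ hℓd => ?_) ?_ hA₀W hW j (by omega)
  · -- report: `cc′(ℓ)²ΓR ≤ 8^ℓ·Q_o.CE`
    rw [hQoCE, hQRCE]
    have h8 : (1 : ℝ) ≤ (8 : ℝ) ^ ℓ := one_le_pow₀ (by norm_num)
    have hcc : max (81 * (2 : ℝ) ^ ℓ * CJ' / 2) 1 ≤ ccd := ccPrime_mono hCJ'.le hℓd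
    have h0 : 0 ≤ max (81 * (2 : ℝ) ^ ℓ * CJ' / 2) 1 := zero_le_one.trans (le_max_right _ _)
    calc max (81 * (2 : ℝ) ^ ℓ * CJ' / 2) 1 ^ 2 * Γ * Rr ≤ ccd ^ 2 * Γ * Rr := by gcongr
      _ ≤ (8 : ℝ) ^ ℓ * (ccd ^ 2 * Γ * Rr) := le_mul_of_one_le_left (by positivity) h8
  · -- reproduction: `cc′(d′)²Γ·R ≤ 8^{d′}·R`
    rw [hQRCE]
    exact mul_le_mul_of_nonneg_right hcore hR0.le

end Summit.HubbardSuperconductivity.HubbardSuperconductivity.Theorems.TwoVolumeDefect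

end
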